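import Literature.NumberTheory.ConnesConsani2021.ScalingOperator
import HarnessLib

/-!
# `ϑ(g) ϑ(e^s) = ϑ(e^s) ϑ(g) = ϑ(g(· − s))`: composing the integrated scaling operator with a single dilation
# translates the test function

LABEL (line 1): RH-FREE literature (theorems only; NO definition, NO named fact).  bears_on: LADDER-RH
W-C/W-P (C1 named-fact debt), cell `rh-crit`, sub-cell cc, overflow row O1 — glue for the "annulus road"
under `Connes1999_thm_VII_4_rat` (the VALUE step: `Tr(ϑ(g) Q₀ ϑ_{m log p})|_ev = Tr(ϑ(g(· − m log p)) Q₀)|_ev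
= log p · g(−m log p)`).  WHAT THIS IS NOT: any claim about positivity, Weil's criterion or RH.

Source.  A. Connes, C. Consani, Selecta Math. 27 (2021) [`ConnesConsani2021`], Prop. 2.2 (iii) p. 10 and §4
eq. (40) p. 15 (`ϑ(f) = ∫ f(λ)ϑ(λ) d^*λ` is the integrated form of the representation `ϑ`).

## What is proved

* **`scalingOp_comp_scalingUnitary`** — for integrable `g` and `s ∈ ℝ`:
  `ϑ(g) ∘ ϑ(e^s) = ϑ(τ ↦ g(τ − s))` (`∫ g(τ) ϑ(e^{τ+s}) dτ = ∫ g(τ−s) ϑ(e^τ) dτ`, translation invariance of `dτ`);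
* `scalingUnitary_comp_scalingOp` — the same with `ϑ(e^s)` on the left (the scaling group is commutative).

No instance, notation or attribute; no `def`.
-/

noncomputable section

open _root_.MeasureTheory Complex Set Filter
open scoped Real Topology ComplexConjugate InnerProductSpace

namespace Literature.NumberTheory.Connes2026

open Literature.NumberTheory.LFunctions Literature.Analysis.OperatorTheory
open Literature.NumberTheory.ConnesConsani2021

/-- **`ϑ(g) ϑ(e^s) = ϑ(g(· − s))`** for `g ∈ L¹(ℝ)`: `ϑ(g)ϑ(e^s)η = ∫ g(τ) ϑ(e^τ)ϑ(e^s)η dτ = ∫ g(τ) ϑ(e^{τ+s})η dτ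
= ∫ g(τ − s) ϑ(e^τ)η dτ`. [cite: ConnesConsani2021, Prop. 2.2 (iii) p. 10 and §4 eq. (40) p. 15] -/
theorem scalingOp_comp_scalingUnitary {g : ℝ → ℂ} (hg : Integrable g) (s : ℝ) :
    scalingOp g ∘L scalingUnitary s = scalingOp (fun τ => g (τ - s)) := by
  have hg' : Integrable (fun τ => g (τ - s)) := hg.comp_sub_right s
  refine ContinuousLinearMap.ext fun η => ?_
  rw [ContinuousLinearMap.comp_apply, scalingOp_apply hg, scalingOp_apply hg']
  -- `∫ g(τ) ϑ(τ)(ϑ(s)η) dτ = ∫ g(τ) ϑ(τ+s) η dτ = ∫ g(τ−s) ϑ(τ) η dτ`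
  have h1 : (fun τ => g τ • scalingUnitary τ (scalingUnitary s η)) = fun τ => g τ • scalingUnitary (τ + s) η := by
    funext τ
    rw [scalingUnitary_add, ContinuousLinearMap.comp_apply]
  rw [h1]
  have h2 := integral_sub_right_eq_self (μ := (volume : Measure ℝ)) (fun τ => g τ • scalingUnitary (τ + s) η) s
  -- `h2 : ∫ τ, g (τ - s) • ϑ(τ - s + s) η = ∫ τ, g τ • ϑ(τ + s) η`
  rw [← h2]
  refine integral_congr_ae (Eventually.of_forall fun τ => ?_)
  simp only [sub_add_cancel]

/-- **`ϑ(e^s) ϑ(g) = ϑ(g(· − s))`** (the scaling group is commutative). [cite: ConnesConsani2021, Prop. 2.2 (iii) p. 10 and §4 eq. (40) p. 15] -/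
theorem scalingUnitary_comp_scalingOp {g : ℝ → ℂ} (hg : Integrable g) (s : ℝ) :
    scalingUnitary s ∘L scalingOp g = scalingOp (fun τ => g (τ - s)) := by
  rw [← scalingOp_comp_scalingUnitary hg s]
  refine ContinuousLinearMap.ext fun η => ?_
  rw [ContinuousLinearMap.comp_apply, ContinuousLinearMap.comp_apply, scalingOp_apply hg, scalingOp_apply hg,
    ← ContinuousLinearMap.integral_comp_comm _ (integrable_smul_scalingUnitary hg η)]
  refine integral_congr_ae (Eventually.of_forall fun τ => ?_)
  show scalingUnitary s (g τ • scalingUnitary τ η) = g τ • scalingUnitary τ (scalingUnitary s η)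
  rw [ContinuousLinearMap.map_smul]
  congr 1
  rw [← ContinuousLinearMap.comp_apply, ← ContinuousLinearMap.comp_apply, ← scalingUnitary_add,
    ← scalingUnitary_add, add_comm]

end Literature.NumberTheory.Connes2026
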